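import Summits.CriticalPhenomena.CardyFormulaZ2.Theorems.CardyComplexConeEdgePrecompactUFRSLastDeparture

/-!
# Towards the disc rigidity of the turning (registered sub-goal `ufrs_bigonTurning`): reduction to the divergent window
(line `qkz-strip-boundary-arm` of crux `CardyComplexCone.EdgePrecompact`, stmt-CriticalPhenomena-11387;
item (M2) of the corrected road map for the uniform forward response stability "UFRS", module
docstrings of `…EdgePrecompactUFRSAnnulusCrossings.lean` and `…EdgePrecompactUFRSEvents.lean`)

`ufrs_bigonTurning` (registered, OPEN): two simple orbit stretches `O₀ c [0, n₀]` (dynamics `β₀`)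
and `O₁ c [0, n₁]` (dynamics `β₁`) with a common prefix `[0, s)`, `s ≥ 1`, and a common suffix
`O₀ c (t₀ + u) = O₁ c (t₁ + u)`, `u ≤ n₀ - t₀ = n₁ - t₁`, whose middle parts have their vertices
inside a disc avoiding the start and the end vertex, have equal turning sums. This file proves the
bookkeeping half (`bigonTurning_reduction`): WITHOUT any geometric hypothesis, the difference of
the two turning sums equals the difference over the WINDOWS `[s - 1, t₀)` and `[s - 1, t₁)` — the
entry corner `O c (s - 1)` (common corner, possibly different turns: the split) followed by the two
middle parts up to the merge into the common suffix; prefix and suffix contribute equally because a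
common corner with a common successor has a common turn (`turnOf_eq_of_nextCorner_eq`). What remains
for `ufrs_bigonTurning` is the planar statement that this window difference vanishes when the two
middle parts lie in a disc avoiding start and end: with `J = mid₀ · mid₁⁻¹` (a cusp-free closed
medial polygon: the two successors of the entry corner are the opposite out-darts of one medial
vertex, the two predecessors of the first suffix corner its opposite in-darts) the window
difference is `π s_in + 2π w(J) + π s_out`; two routes: (T) close `S₀` and `S₁` by ONE forward dart
path `κ` avoiding both (directed reachability in the oriented medial graph outside `J`) and apply
the trail Umlaufsatz `MedialTrail.inv_of_isTrail` to the closed trails `Sᵢ · κ`, comparing their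
winding numbers at a face far from the disc; (H) Hopf for the perturbed polygon of `J`
(`PolygonUmlaufsatz`, pattern of `MedialCycleTurning.lean`) plus the local side analysis at the two
junctions along the prefix and the suffix (pattern of `MedialCycleSeparation.lean`).

References: H. Hopf, Compositio Math. 2 (1935); S. Smirnov, C. R. Acad. Sci. Paris 333 (2001), §2.
-/

namespace Summit.CriticalPhenomena.CardyFormulaZ2.Cruxes.EdgePrecompact.QkzStripBoundaryArm

open MeasureTheory Filter Set Metric
open scoped Topology BigOperators Pointwise
open Literature.Probability.LatticeModels Literature.Probability.Percolation
open Literature.Probability.RandomPlanarGeometry (DobrushinDomain)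
open Summit.CriticalPhenomena.CardyFormulaZ2.Theses.CardyComplexCone

noncomputable section

/-! ## Common successor, common turn -/

/-- **Equal successors, equal status**: if the two dynamics send `p` to the same corner, its
target edge has the same status in `β₀` and `β₁` (the successor's face index records the turn). -/
theorem iff_of_nextCorner_eq {β₀ β₁ : BondConfig (Site 2)} {p : Site 2 × Fin 4}
    (h : nextCorner β₀ p = nextCorner β₁ p) : (cTgt p ∈ β₀ ↔ cTgt p ∈ β₁) := by
  have hk : ∀ k : Fin 4, k + 3 ≠ k + 1 := by decide
  by_cases h₀ : cTgt p ∈ β₀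
  · by_cases h₁ : cTgt p ∈ β₁
    · exact ⟨fun _ => h₁, fun _ => h₀⟩
    · rw [nextCorner_of_mem h₀, nextCorner_of_not_mem h₁, Prod.mk.injEq] at h
      exact absurd h.2 (hk p.2)
  · by_cases h₁ : cTgt p ∈ β₁
    · rw [nextCorner_of_not_mem h₀, nextCorner_of_mem h₁, Prod.mk.injEq] at h
      exact absurd h.2.symm (hk p.2)
    · exact ⟨fun h => absurd h h₀, fun h => absurd h h₁⟩

/-- **Equal successors, equal turns.** -/
theorem turnOf_eq_of_nextCorner_eq {β₀ β₁ : BondConfig (Site 2)} {p : Site 2 × Fin 4}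
    (h : nextCorner β₀ p = nextCorner β₁ p) : turnOf β₀ p = turnOf β₁ p :=
  turnOf_congr_of_iff (iff_of_nextCorner_eq h)

/-! ## The reduction to the divergent window -/

/-- Turns agree along a common stretch with common successors: if `O₀ c (a₀ + u) = O₁ c (a₁ + u)`
for all `u ≤ L`, the turning sums over `[a₀, a₀ + L)` and `[a₁, a₁ + L)` agree. -/
theorem sum_turnOf_eq_of_agree (β₀ β₁ : BondConfig (Site 2)) (c : Site 2 × Fin 4) (a₀ a₁ L : ℕ)
    (hagree : ∀ u, u ≤ L → cornerOrbit β₀ c (a₀ + u) = cornerOrbit β₁ c (a₁ + u)) :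
    ∑ u ∈ Finset.range L, turnOf β₀ (cornerOrbit β₀ c (a₀ + u)) =
      ∑ u ∈ Finset.range L, turnOf β₁ (cornerOrbit β₁ c (a₁ + u)) := by
  refine Finset.sum_congr rfl fun u hu => ?_
  rw [Finset.mem_range] at hu
  have h0 := hagree u hu.le
  have h1 := hagree (u + 1) hu
  have hnext : nextCorner β₀ (cornerOrbit β₀ c (a₀ + u)) = nextCorner β₁ (cornerOrbit β₁ c (a₁ + u)) := by
    show cornerOrbit β₀ c (a₀ + u + 1) = cornerOrbit β₁ c (a₁ + u + 1)
    rw [add_assoc, add_assoc]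
    exact h1
  rw [h0] at hnext ⊢
  exact turnOf_eq_of_nextCorner_eq hnext

/-- Splitting a sum over `range n` at `a ≤ b ≤ n` into `range a`, the window `Ico a b` and the
tail written as a shifted range. -/
private theorem sum_range_split_U4 (f : ℕ → ℝ) {a b n : ℕ} (hab : a ≤ b) (hbn : b ≤ n) :
    ∑ t ∈ Finset.range n, f t =
      ∑ t ∈ Finset.range a, f t + ∑ t ∈ Finset.Ico a b, f t + ∑ u ∈ Finset.range (n - b), f (b + u) := by
  rw [Finset.range_eq_Ico, ← Finset.sum_Ico_consecutive f (Nat.zero_le b) hbn,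
    ← Finset.sum_Ico_consecutive f (Nat.zero_le a) hab, Finset.sum_Ico_eq_sum_range f b n,
    Finset.range_eq_Ico, Finset.range_eq_Ico]

/-- **Reduction of the turning mismatch to the divergent window** (first half of the registered
sub-goal `ufrs_bigonTurning`, no geometry). Two orbits from the same corner `c` with a common
prefix `[0, s)` (`1 ≤ s ≤ t₀, t₁`) and a common suffix `O₀ c (t₀ + u) = O₁ c (t₁ + u)` for
`u ≤ n₀ - t₀ = n₁ - t₁`: the difference of the full turning sums is the difference of the sums over
the windows `[s - 1, t₀)` and `[s - 1, t₁)`. -/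
theorem bigonTurning_reduction (β₀ β₁ : BondConfig (Site 2)) (c : Site 2 × Fin 4) (n₀ n₁ s t₀ t₁ : ℕ)
    (hs : 1 ≤ s) (hst₀ : s ≤ t₀) (ht₀ : t₀ ≤ n₀) (hst₁ : s ≤ t₁) (ht₁ : t₁ ≤ n₁)
    (hpre : ∀ t < s, cornerOrbit β₀ c t = cornerOrbit β₁ c t) (hlen : n₀ - t₀ = n₁ - t₁)
    (hsuf : ∀ u, u ≤ n₀ - t₀ → cornerOrbit β₀ c (t₀ + u) = cornerOrbit β₁ c (t₁ + u)) :
    ∑ t ∈ Finset.range n₀, turnOf β₀ (cornerOrbit β₀ c t) - ∑ t ∈ Finset.range n₁, turnOf β₁ (cornerOrbit β₁ c t) =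
      ∑ t ∈ Finset.Ico (s - 1) t₀, turnOf β₀ (cornerOrbit β₀ c t) -
        ∑ t ∈ Finset.Ico (s - 1) t₁, turnOf β₁ (cornerOrbit β₁ c t) := by
  rw [sum_range_split_U4 (fun t => turnOf β₀ (cornerOrbit β₀ c t)) (show s - 1 ≤ t₀ by omega) ht₀,
    sum_range_split_U4 (fun t => turnOf β₁ (cornerOrbit β₁ c t)) (show s - 1 ≤ t₁ by omega) ht₁]
  -- the prefixes `[0, s - 1)` agree
  have hpre' : ∑ t ∈ Finset.range (s - 1), turnOf β₀ (cornerOrbit β₀ c t) =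
      ∑ t ∈ Finset.range (s - 1), turnOf β₁ (cornerOrbit β₁ c t) := by
    have := sum_turnOf_eq_of_agree β₀ β₁ c 0 0 (s - 1) (fun u hu => by
      simpa only [zero_add] using hpre u (by omega))
    simpa only [zero_add] using this
  -- the suffixes agree
  have hsuf' : ∑ u ∈ Finset.range (n₀ - t₀), turnOf β₀ (cornerOrbit β₀ c (t₀ + u)) =
      ∑ u ∈ Finset.range (n₁ - t₁), turnOf β₁ (cornerOrbit β₁ c (t₁ + u)) := by
    rw [← hlen]
    exact sum_turnOf_eq_of_agree β₀ β₁ c t₀ t₁ (n₀ - t₀) hsuf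
  rw [hpre', hsuf']
  ring

/-- **Reduction of the turning mismatch to the divergent window** (registered sub-goal
`ufrs_bigonTurning_reduction` of stmt-CriticalPhenomena-11387, the geometry-free half of
`ufrs_bigonTurning`; `∀`-form of `bigonTurning_reduction`). -/
theorem ufrs_bigonTurning_reduction : ∀ (β₀ β₁ : BondConfig (Site 2)) (c : Site 2 × Fin 4) (n₀ n₁ s t₀ t₁ : ℕ), 1 ≤ s → s ≤ t₀ → t₀ ≤ n₀ → s ≤ t₁ → t₁ ≤ n₁ → (∀ t < s, cornerOrbit β₀ c t = cornerOrbit β₁ c t) → n₀ - t₀ = n₁ - t₁ → (∀ u, u ≤ n₀ - t₀ → cornerOrbit β₀ c (t₀ + u) = cornerOrbit β₁ c (t₁ + u)) → ∑ t ∈ Finset.range n₀, turnOf β₀ (cornerOrbit β₀ c t) - ∑ t ∈ Finset.range n₁, turnOf β₁ (cornerOrbit β₁ c t) = ∑ t ∈ Finset.Ico (s - 1) t₀, turnOf β₀ (cornerOrbit β₀ c t) - ∑ t ∈ Finset.Ico (s - 1) t₁, turnOf β₁ (cornerOrbit β₁ c t) :=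
  fun β₀ β₁ c n₀ n₁ s t₀ t₁ hs hst₀ ht₀ hst₁ ht₁ hpre hlen hsuf =>
    bigonTurning_reduction β₀ β₁ c n₀ n₁ s t₀ t₁ hs hst₀ ht₀ hst₁ ht₁ hpre hlen hsuf

end

end Summit.CriticalPhenomena.CardyFormulaZ2.Cruxes.EdgePrecompact.QkzStripBoundaryArm
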